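import Literature.NumberTheory.LFunctions.Zhang2022.DHMenuConsistentWorld

/-!
# Zhang (2022), rung F-S3, family B-dh — world lemma W7 for `DH.MenuConsistent`: the RvM picket fence of `W(D, χ)`
# (the main term `F_f` is strictly increasing beyond `2π/f`; `γ_n(f)` is the root of `F_f = 2n − 1`; `γ_n ≤ T ↔ 2n − 1 ≤ F_f(T)`;
# `γ` is strictly increasing; the number of fence ordinates `≤ T` is `⌊(F_f(T) + 1)/2⌋₊`)

Y. Zhang, *Discrete mean estimates and the Landau–Siegel zero*, arXiv:2211.02515v1 [Zhang2022LandauSiegel] — an unrefereed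
manuscript under adjudication. **The programme SEARCHES and TYPES; no claim about Landau–Siegel zeros, Theorems 1–2 of
arXiv:2211.02515 or a repaired Margin232 until a kernel theorem says so.** Nothing here concerns an actual `L`-function: the
«fence» is the cell's model of a zero set with Riemann–von Mangoldt counting function (B-dh KILL-draft §3); this file is
real analysis of `F_f(T) = (T/π) log(fT/(2πe))` (`DH.rvmMain`) and of `γ_n(f) = inf{T ≥ 0 : 2n − 1 ≤ F_f(T)}`
(`DH.fenceOrdinate`). Cell `landau-siegel`, sub-cell E, stub S-E-p4-5 (row13a of B-dh/SIGMA-E-HANDOVER.md v1 85415a87d174988f,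
«(W7) … stub: strict monotonicity of `rvmMain f` on its nonnegative branch and `fenceOrdinate f n < fenceOrdinate f (n+1)`»).

## Contents (`f ≥ 1` throughout; `a_f := 2πe/f` is where `F_f` vanishes)

* `hasDerivAt_rvmMain` (`F_f′(T) = (log(fT/(2πe)) + 1)/π`, `T > 0`), `rvmMain_deriv_pos` (`> 0` for `T > 2π/f`),
  `continuousOn_rvmMain` (on `(0,∞)`), **`strictMonoOn_rvmMain`** (on `[2π/f, ∞)`), `rvmMain_twoPiE` (`F_f(a_f) = 0`),
  `rvmMain_ge_div_pi` (`F_f(T) ≥ T/π` for `fT ≥ 2πe²`), `exists_rvmMain_eq` (IVT: every `y ≥ 0` is a value on `[a_f, ∞)`).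
* **`rvmMain_fenceOrdinate`** (`F_f(γ_n) = 2n − 1`), `two_pi_e_div_lt_fenceOrdinate` (`γ_n > a_f`), `fenceSet_eq_Ici`
  (the defining set IS `[γ_n, ∞)`), **`fenceOrdinate_le_iff`** (`γ_n ≤ T ↔ 2n − 1 ≤ F_f(T)` for `T ≥ 0`),
  **`fenceOrdinate_lt_succ`** / `fenceOrdinate_strictMono` (`γ_n < γ_{n+1}`), `fenceOrdinate_succ_injective`.
* **`fenceOrdinate_le_iff_le_count`**: for `T ≥ 0` and `n ≥ 1`, `γ_n ≤ T ↔ n ≤ fenceCount f T` with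
  `fenceCount f T := ⌊(F_f(T) + 1)/2⌋₊` — the number of positive ordinates up to height `T` (the fence then has `2·fenceCount`
  points with `|Im| ≤ T`; the `stripCount` bookkeeping over `DH.world` is the companion row13b).

References: [BennettMartinOBryantRechnitzer2021] Thm 1.1 (the RvM main term); the fence is the cell's device.
-/

noncomputable section

open scoped Classical
open Complex Set

namespace Literature.NumberTheory.LFunctions.Zhang2022.DH

/-! ### The main term `F_f`: derivative, monotonicity, values -/

/-- `F_f′(T) = (log(fT/(2πe)) + 1)/π` for `T > 0` (`f ≥ 1`). [cite: BennettMartinOBryantRechnitzer2021, Theorem 1.1] -/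
theorem hasDerivAt_rvmMain {f : ℕ} (hf : 1 ≤ f) {T : ℝ} (hT : 0 < T) :
    HasDerivAt (rvmMain f) ((Real.log (f * T / (2 * Real.pi * Real.exp 1)) + 1) / Real.pi) T := by
  have hf' : (0:ℝ) < f := by exact_mod_cast hf
  have hc : 0 < 2 * Real.pi * Real.exp 1 := by positivity
  have h1 : HasDerivAt (fun T : ℝ => (f : ℝ) * T / (2 * Real.pi * Real.exp 1)) ((f : ℝ) / (2 * Real.pi * Real.exp 1)) T := by
    have := ((hasDerivAt_id T).const_mul (f : ℝ)).div_const (2 * Real.pi * Real.exp 1)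
    simpa using this
  have hx : (f : ℝ) * T / (2 * Real.pi * Real.exp 1) ≠ 0 := by positivity
  have h2 := h1.log hx
  have h3 : HasDerivAt (fun T : ℝ => T / Real.pi) (1 / Real.pi) T := by
    have := (hasDerivAt_id T).div_const Real.pi
    simpa using this
  have h4 := h3.mul h2
  have e : rvmMain f = fun T => T / Real.pi * Real.log (f * T / (2 * Real.pi * Real.exp 1)) := rfl
  rw [e]
  refine h4.congr_deriv ?_
  have key : (f : ℝ) / (2 * Real.pi * Real.exp 1) / ((f : ℝ) * T / (2 * Real.pi * Real.exp 1)) = 1 / T := by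
    rw [div_div_div_cancel_right₀ hc.ne', div_eq_div_iff (mul_pos hf' hT).ne' hT.ne']
    ring
  rw [key]
  have hT' : T ≠ 0 := hT.ne'
  have hπ : Real.pi ≠ 0 := Real.pi_ne_zero
  have e2 : T / Real.pi * (1 / T) = 1 / Real.pi := by
    rw [div_mul_div_comm, mul_one, mul_comm Real.pi T, ← div_div, div_self hT']
  rw [e2]
  ring

/-- `log(fT/(2πe)) + 1 = log(fT/(2π))`. [cite: BennettMartinOBryantRechnitzer2021, Theorem 1.1] -/
theorem log_add_one_eq {f : ℕ} (hf : 1 ≤ f) {T : ℝ} (hT : 0 < T) :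
    Real.log (f * T / (2 * Real.pi * Real.exp 1)) + 1 = Real.log (f * T / (2 * Real.pi)) := by
  have hf' : (0:ℝ) < f := by exact_mod_cast hf
  have e : (f : ℝ) * T / (2 * Real.pi * Real.exp 1) = (f * T / (2 * Real.pi)) / Real.exp 1 := by
    field_simp
  rw [e, Real.log_div (by positivity) (Real.exp_pos 1).ne', Real.log_exp]
  ring

/-- `F_f′ > 0` beyond `2π/f`. [cite: BennettMartinOBryantRechnitzer2021, Theorem 1.1] -/
theorem rvmMain_deriv_pos {f : ℕ} (hf : 1 ≤ f) {T : ℝ} (hT : 2 * Real.pi / f < T) :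
    0 < (Real.log (f * T / (2 * Real.pi * Real.exp 1)) + 1) / Real.pi := by
  have hf' : (0:ℝ) < f := by exact_mod_cast hf
  have hT0 : 0 < T := lt_trans (by positivity) hT
  rw [log_add_one_eq hf hT0]
  refine div_pos (Real.log_pos ?_) Real.pi_pos
  rw [lt_div_iff₀ (by positivity)]
  calc 1 * (2 * Real.pi) = f * (2 * Real.pi / f) := by field_simp
    _ < f * T := by gcongr

/-- `F_f` is continuous on `(0, ∞)`. [cite: BennettMartinOBryantRechnitzer2021, Theorem 1.1] -/
theorem continuousOn_rvmMain {f : ℕ} (hf : 1 ≤ f) : ContinuousOn (rvmMain f) (Ioi 0) :=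
  fun _ hT => (hasDerivAt_rvmMain hf hT).continuousAt.continuousWithinAt

/-- **`F_f` is strictly increasing on `[2π/f, ∞)`.** [cite: BennettMartinOBryantRechnitzer2021, Theorem 1.1] -/
theorem strictMonoOn_rvmMain {f : ℕ} (hf : 1 ≤ f) : StrictMonoOn (rvmMain f) (Ici (2 * Real.pi / f)) := by
  have hf' : (0:ℝ) < f := by exact_mod_cast hf
  have ha : 0 < 2 * Real.pi / f := by positivity
  refine strictMonoOn_of_deriv_pos (convex_Ici _) ((continuousOn_rvmMain hf).mono fun T hT => lt_of_lt_of_le ha hT) ?_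
  intro T hT
  rw [interior_Ici] at hT
  rw [(hasDerivAt_rvmMain hf (lt_trans ha hT)).deriv]
  exact rvmMain_deriv_pos hf hT

/-- `2π/f ≤ 2πe/f`. [folklore] -/
private theorem two_pi_div_le_two_pi_e_div (f : ℕ) : 2 * Real.pi / f ≤ 2 * Real.pi * Real.exp 1 / f := by
  rcases Nat.eq_zero_or_pos f with h | h
  · subst h; simp
  · have hf' : (0:ℝ) < f := by exact_mod_cast h
    rw [div_le_div_iff_of_pos_right hf']
    have : (1:ℝ) ≤ Real.exp 1 := Real.one_le_exp zero_le_one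
    nlinarith [Real.pi_pos]

/-- `F_f(2πe/f) = 0`. [cite: BennettMartinOBryantRechnitzer2021, Theorem 1.1] -/
theorem rvmMain_twoPiE {f : ℕ} (hf : 1 ≤ f) : rvmMain f (2 * Real.pi * Real.exp 1 / f) = 0 := by
  have hf' : (0:ℝ) < f := by exact_mod_cast hf
  unfold rvmMain
  have : (f : ℝ) * (2 * Real.pi * Real.exp 1 / f) / (2 * Real.pi * Real.exp 1) = 1 := by
    field_simp
  rw [this, Real.log_one, mul_zero]

/-- `F_f(T) ≥ T/π` once `T ≥ 2πe²` (`f ≥ 1`). [cite: BennettMartinOBryantRechnitzer2021, Theorem 1.1] -/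
theorem rvmMain_ge_div_pi {f : ℕ} (hf : 1 ≤ f) {T : ℝ} (hT : 2 * Real.pi * Real.exp 1 ^ 2 ≤ T) : T / Real.pi ≤ rvmMain f T := by
  have hf' : (1:ℝ) ≤ f := by exact_mod_cast hf
  have hTpos : 0 < T := lt_of_lt_of_le (by positivity) hT
  have hx : Real.exp 1 ≤ (f : ℝ) * T / (2 * Real.pi * Real.exp 1) := by
    rw [le_div_iff₀ (by positivity)]
    calc Real.exp 1 * (2 * Real.pi * Real.exp 1) = 1 * (2 * Real.pi * Real.exp 1 ^ 2) := by ring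
      _ ≤ (f : ℝ) * T := by gcongr
  have hlog : 1 ≤ Real.log ((f : ℝ) * T / (2 * Real.pi * Real.exp 1)) := by
    rw [Real.le_log_iff_exp_le (by positivity)]; exact hx
  unfold rvmMain
  calc T / Real.pi = T / Real.pi * 1 := by ring
    _ ≤ T / Real.pi * Real.log ((f : ℝ) * T / (2 * Real.pi * Real.exp 1)) := by gcongr

/-- **Every `y ≥ 0` is a value of `F_f` on `[2πe/f, ∞)`** (intermediate value theorem).
[cite: BennettMartinOBryantRechnitzer2021, Theorem 1.1] -/
theorem exists_rvmMain_eq {f : ℕ} (hf : 1 ≤ f) {y : ℝ} (hy : 0 ≤ y) :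
    ∃ T : ℝ, 2 * Real.pi * Real.exp 1 / f ≤ T ∧ rvmMain f T = y := by
  have hf' : (1:ℝ) ≤ f := by exact_mod_cast hf
  set a : ℝ := 2 * Real.pi * Real.exp 1 / f with ha
  have ha0 : 0 < a := by positivity
  set b : ℝ := max a (max (2 * Real.pi * Real.exp 1 ^ 2) (Real.pi * y)) with hb
  have hab : a ≤ b := le_max_left _ _
  have hb1 : 2 * Real.pi * Real.exp 1 ^ 2 ≤ b := le_trans (le_max_left _ _) (le_max_right _ _)
  have hb2 : Real.pi * y ≤ b := le_trans (le_max_right _ _) (le_max_right _ _)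
  have hcont : ContinuousOn (rvmMain f) (Icc a b) :=
    (continuousOn_rvmMain hf).mono fun T hT => lt_of_lt_of_le ha0 hT.1
  have hya : rvmMain f a ≤ y := by rw [ha, rvmMain_twoPiE hf]; exact hy
  have hyb : y ≤ rvmMain f b := by
    refine le_trans ?_ (rvmMain_ge_div_pi hf hb1)
    rw [le_div_iff₀ Real.pi_pos]; linarith
  obtain ⟨T, hT, hval⟩ := intermediate_value_Icc hab hcont ⟨hya, hyb⟩
  exact ⟨T, hT.1, hval⟩

/-! ### `γ_n(f)` is the root of `F_f = 2n − 1` beyond `2πe/f` -/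

/-- **The defining set of `γ_n` is a closed ray** `[T₀, ∞)` with `F_f(T₀) = 2n − 1`, `T₀ > 2πe/f` (`f, n ≥ 1`).
[cite: BennettMartinOBryantRechnitzer2021, Theorem 1.1] -/
theorem fenceSet_eq_Ici {f n : ℕ} (hf : 1 ≤ f) (hn : 1 ≤ n) :
    ∃ T₀ : ℝ, 2 * Real.pi * Real.exp 1 / f < T₀ ∧ rvmMain f T₀ = 2 * (n : ℝ) - 1 ∧
      {T : ℝ | 0 ≤ T ∧ (2 * (n : ℝ) - 1) ≤ rvmMain f T} = Ici T₀ := by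
  have hf' : (0:ℝ) < f := by exact_mod_cast hf
  have hn' : (1:ℝ) ≤ n := by exact_mod_cast hn
  obtain ⟨T₀, hT₀a, hval⟩ := exists_rvmMain_eq hf (y := 2 * (n : ℝ) - 1) (by linarith)
  have ha0 : 0 < 2 * Real.pi * Real.exp 1 / f := by positivity
  have hT₀pos : 0 < T₀ := lt_of_lt_of_le ha0 hT₀a
  have hT₀a' : 2 * Real.pi * Real.exp 1 / f < T₀ := by
    rcases hT₀a.lt_or_eq with h | h
    · exact h
    · exfalso; rw [← h, rvmMain_twoPiE hf] at hval; linarith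
  have hmono := strictMonoOn_rvmMain hf
  have hsub : ∀ T : ℝ, 2 * Real.pi * Real.exp 1 / f ≤ T → T ∈ Ici (2 * Real.pi / f) :=
    fun T hT => le_trans (two_pi_div_le_two_pi_e_div f) hT
  refine ⟨T₀, hT₀a', hval, Set.ext fun T => ⟨fun hT => ?_, fun hT => ?_⟩⟩
  · -- `T` admissible ⇒ `T > 2πe/f` and `F(T) ≥ F(T₀)` ⇒ `T ≥ T₀`
    have hTa := two_pi_e_div_lt_of_mem_fenceSet hf hn hT
    by_contra hlt
    have hlt' : T < T₀ := lt_of_not_ge hlt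
    have := hmono (hsub T hTa.le) (hsub T₀ hT₀a) hlt'
    rw [hval] at this
    exact absurd hT.2 (not_le.2 this)
  · refine ⟨hT₀pos.le.trans hT, ?_⟩
    rcases (show T₀ ≤ T from hT).lt_or_eq with h | h
    · have := hmono (hsub T₀ hT₀a) (hsub T (hT₀a.trans hT)) h
      rw [hval] at this; exact this.le
    · rw [← h, hval]

/-- **`F_f(γ_n(f)) = 2n − 1`** (`f, n ≥ 1`). [cite: BennettMartinOBryantRechnitzer2021, Theorem 1.1] -/
theorem rvmMain_fenceOrdinate {f n : ℕ} (hf : 1 ≤ f) (hn : 1 ≤ n) :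
    rvmMain f (fenceOrdinate f n) = 2 * (n : ℝ) - 1 := by
  obtain ⟨T₀, -, hval, hS⟩ := fenceSet_eq_Ici hf hn
  unfold fenceOrdinate
  rw [hS, csInf_Ici]
  exact hval

/-- `γ_n(f) > 2πe/f` (`f, n ≥ 1`). [cite: BennettMartinOBryantRechnitzer2021, Theorem 1.1] -/
theorem two_pi_e_div_lt_fenceOrdinate {f n : ℕ} (hf : 1 ≤ f) (hn : 1 ≤ n) :
    2 * Real.pi * Real.exp 1 / f < fenceOrdinate f n := by
  obtain ⟨T₀, hT₀, -, hS⟩ := fenceSet_eq_Ici hf hn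
  unfold fenceOrdinate
  rw [hS, csInf_Ici]
  exact hT₀

/-- `γ_n(f)` lies in the monotonicity ray `[2π/f, ∞)`. [cite: BennettMartinOBryantRechnitzer2021, Theorem 1.1] -/
theorem fenceOrdinate_mem_Ici {f n : ℕ} (hf : 1 ≤ f) (hn : 1 ≤ n) : fenceOrdinate f n ∈ Ici (2 * Real.pi / f) :=
  le_trans (two_pi_div_le_two_pi_e_div f) (two_pi_e_div_lt_fenceOrdinate hf hn).le

/-- **`γ_n ≤ T ↔ 2n − 1 ≤ F_f(T)`** for `T ≥ 0` (`f, n ≥ 1`): the fence ordinates up to `T` are read off the main term.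
[cite: BennettMartinOBryantRechnitzer2021, Theorem 1.1] -/
theorem fenceOrdinate_le_iff {f n : ℕ} (hf : 1 ≤ f) (hn : 1 ≤ n) {T : ℝ} (hT : 0 ≤ T) :
    fenceOrdinate f n ≤ T ↔ 2 * (n : ℝ) - 1 ≤ rvmMain f T := by
  obtain ⟨T₀, -, -, hS⟩ := fenceSet_eq_Ici hf hn
  have hγ : fenceOrdinate f n = T₀ := by unfold fenceOrdinate; rw [hS, csInf_Ici]
  constructor
  · intro h
    have : T ∈ Ici T₀ := hγ ▸ h
    rw [← hS] at this
    exact this.2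
  · intro h
    have : T ∈ ({T : ℝ | 0 ≤ T ∧ (2 * (n : ℝ) - 1) ≤ rvmMain f T} : Set ℝ) := ⟨hT, h⟩
    rw [hS] at this
    rw [hγ]; exact this

/-- **The ordinates increase strictly: `γ_n < γ_{n+1}`** (`f, n ≥ 1`). [cite: BennettMartinOBryantRechnitzer2021, Theorem 1.1] -/
theorem fenceOrdinate_lt_succ {f n : ℕ} (hf : 1 ≤ f) (hn : 1 ≤ n) : fenceOrdinate f n < fenceOrdinate f (n + 1) := by
  have h1 := rvmMain_fenceOrdinate hf hn
  have h2 := rvmMain_fenceOrdinate hf (Nat.le_succ_of_le hn)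
  have hlt : rvmMain f (fenceOrdinate f n) < rvmMain f (fenceOrdinate f (n + 1)) := by
    rw [h1, h2]; push_cast; linarith
  exact ((strictMonoOn_rvmMain hf).lt_iff_lt (fenceOrdinate_mem_Ici hf hn)
    (fenceOrdinate_mem_Ici hf (Nat.le_succ_of_le hn))).1 hlt

/-- `n ↦ γ_{n+1}(f)` is strictly increasing (`f ≥ 1`). [cite: BennettMartinOBryantRechnitzer2021, Theorem 1.1] -/
theorem fenceOrdinate_succ_strictMono {f : ℕ} (hf : 1 ≤ f) : StrictMono fun n : ℕ => fenceOrdinate f (n + 1) :=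
  strictMono_nat_of_lt_succ fun n => fenceOrdinate_lt_succ hf (Nat.succ_le_succ (Nat.zero_le n))

/-- `n ↦ γ_{n+1}(f)` is injective (`f ≥ 1`): the fence points `½ ± iγ_{n+1}` are pairwise distinct.
[cite: BennettMartinOBryantRechnitzer2021, Theorem 1.1] -/
theorem fenceOrdinate_succ_injective {f : ℕ} (hf : 1 ≤ f) : Function.Injective fun n : ℕ => fenceOrdinate f (n + 1) :=
  (fenceOrdinate_succ_strictMono hf).injective

/-! ### Counting the ordinates below a height -/

/-- The number of positive fence ordinates up to height `T`: `⌊(F_f(T) + 1)/2⌋₊`. [cite: BennettMartinOBryantRechnitzer2021, Theorem 1.1] -/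
def fenceCount (f : ℕ) (T : ℝ) : ℕ := ⌊(rvmMain f T + 1) / 2⌋₊

/-- **`γ_n ≤ T ↔ n ≤ fenceCount f T`** for `n ≥ 1`, `T ≥ 0` (`f ≥ 1`): the ordinates not exceeding `T` are exactly
`γ_1 < ⋯ < γ_N`, `N = ⌊(F_f(T)+1)/2⌋₊`. [cite: BennettMartinOBryantRechnitzer2021, Theorem 1.1] -/
theorem fenceOrdinate_le_iff_le_count {f n : ℕ} (hf : 1 ≤ f) (hn : 1 ≤ n) {T : ℝ} (hT : 0 ≤ T) :
    fenceOrdinate f n ≤ T ↔ n ≤ fenceCount f T := by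
  rw [fenceOrdinate_le_iff hf hn hT, fenceCount]
  have hn' : (1:ℝ) ≤ n := by exact_mod_cast hn
  constructor
  · intro h
    have hx : (n : ℝ) ≤ (rvmMain f T + 1) / 2 := by linarith
    exact Nat.le_floor hx
  · intro h
    by_cases hx : 0 ≤ (rvmMain f T + 1) / 2
    · have := (Nat.le_floor_iff hx).1 h
      linarith
    · have : ⌊(rvmMain f T + 1) / 2⌋₊ = 0 := Nat.floor_of_nonpos (lt_of_not_ge hx).le
      rw [this] at h
      omega

/-- No ordinate lies below height `0 ≤ T < γ_1`; in particular `fenceCount f T = 0` forces all `γ_n > T`.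
[cite: BennettMartinOBryantRechnitzer2021, Theorem 1.1] -/
theorem fenceOrdinate_gt_of_count_eq_zero {f n : ℕ} (hf : 1 ≤ f) (hn : 1 ≤ n) {T : ℝ} (hT : 0 ≤ T)
    (h0 : fenceCount f T = 0) : T < fenceOrdinate f n := by
  by_contra hle
  have := (fenceOrdinate_le_iff_le_count hf hn hT).1 (not_lt.1 hle)
  omega

end Literature.NumberTheory.LFunctions.Zhang2022.DH
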